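import Summits.Ventures.DiscreteObjects.UnitDistance.QuadraticPlanesFourD
import Summits.Ventures.DiscreteObjects.UnitDistance.PlaneSqrt143Bounds
import Summits.Ventures.DiscreteObjects.UnitDistance.ThreeIntegralPlane
import HarnessLib

/-!
# Quadratic planes with chromatic number four, V: the table of `d ≡ 3 (mod 4)` between `100` and `200`, and the 3-integral refinement of the open rows
(cell `pub-namedobj`, target (U), seat udg g15 — summary)

Framing (verbatim for the cell): lottery ticket; floor = certified bounds/negative ranges.

No new witness in this file.  It assembles the rows already in the tree into the second century of the quadratic table and records what the
3-integral theorem (`ThreeIntegralPlane.lean`) adds to the rows that stay open.  For the twenty-one square-free `d ≡ 3 (mod 4)` with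
`100 < d < 200`: `χ(ℚ(√d)²) = 3` for the thirteen `d ≢ 2 (mod 3)` (3-adic criterion + odd zigzag), `= 4` for `d = 119, 131, 179, 191`
(kernel RUP witnesses of udg g13/g14), `∈ {4, 5}` for `d = 143`, `∈ {3, 4}` for `d = 107, 155` (odd cycle; 2-adic criterion, `d ≡ 3 (mod 8)`), and for
`d = 167` (`≡ 7 (mod 8)`, `≡ 2 (mod 3)`; no `p`-adic criterion of the tree applies) only `χ ≥ 3` is recorded here.  REFINEMENT of the three rows
`83, 107, 155` with `χ ∈ {3, 4}`: the 3-integral sub-plane `T_d` (denominators prime to `3`) has `χ(T_d) = 3` exactly, so a fourth colour, if needed,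
is forced only by unit vectors with a `3` in the denominator (`quadratic_open_rows_threeIntegral`).  udg g15's exact search found no such witness for
`83` within hub-local reach (pentagon-free to denominator `600`, heptagon families ≈ 40× sparser than for every decided row; HOME census).
Values `≥ 4` not found in print (PROVISIONAL).
-/

noncomputable section

namespace Summit.Ventures.DiscreteObjects.UnitDistance

open SimpleGraph IntermediateField
open scoped IntermediateField

/-- THE QUADRATIC TABLE FOR SQUARE-FREE `d ≡ 3 (mod 4)`, `100 < d < 200` (twenty-one values): `χ(ℚ(√d)²) = 3` for the thirteen
`d ≢ 2 (mod 3)`; `= 4` for `d = 119, 131, 179, 191`; `4 ≤ χ ≤ 5` for `d = 143`; not `2`-colourable and `4`-colourable (`χ ∈ {3, 4}`) for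
`d = 107, 155`; not `2`-colourable for `d = 167`. -/
theorem quadratic_table_three_mod_four_100_200 :
    (∀ d ∈ ({103, 111, 115, 123, 127, 139, 151, 159, 163, 183, 187, 195, 199} : Finset ℕ),
        (planeUnitDistanceGraph.induce (fieldPoints (multiSqrtField {d}))).chromaticNumber = 3) ∧
    (∀ d ∈ ({119, 131, 179, 191} : Finset ℕ),
        (planeUnitDistanceGraph.induce (fieldPoints (multiSqrtField {d}))).chromaticNumber = 4) ∧
    (4 ≤ (planeUnitDistanceGraph.induce (fieldPoints (multiSqrtField {143}))).chromaticNumber ∧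
      (planeUnitDistanceGraph.induce (fieldPoints (multiSqrtField {143}))).chromaticNumber ≤ 5) ∧
    (∀ d ∈ ({107, 155} : Finset ℕ),
        ¬ (planeUnitDistanceGraph.induce (fieldPoints ℚ⟮Real.sqrt d⟯)).Colorable 2 ∧
          (planeUnitDistanceGraph.induce (fieldPoints ℚ⟮Real.sqrt d⟯)).Colorable 4) ∧
    (∀ d ∈ ({167} : Finset ℕ), ¬ (planeUnitDistanceGraph.induce (fieldPoints ℚ⟮Real.sqrt d⟯)).Colorable 2) := by
  refine ⟨?_, ?_, chromaticNumber_plane_multiSqrtField_143_bounds, ?_, ?_⟩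
  · intro d hd
    simp only [Finset.mem_insert, Finset.mem_singleton] at hd
    rcases hd with rfl | rfl | rfl | rfl | rfl | rfl | rfl | rfl | rfl | rfl | rfl | rfl | rfl <;>
      exact chromaticNumber_plane_eq_three_of_mem_mod_four _ (by decide) (Finset.mem_singleton_self _) (by norm_num)
  · intro d hd
    simp only [Finset.mem_insert, Finset.mem_singleton] at hd
    rcases hd with rfl | rfl | rfl | rfl
    · exact chromaticNumber_plane_multiSqrtField_119
    · exact chromaticNumber_plane_multiSqrtField_131
    · exact chromaticNumber_plane_multiSqrtField_179
    · exact chromaticNumber_plane_multiSqrtField_191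
  · intro d hd
    simp only [Finset.mem_insert, Finset.mem_singleton] at hd
    rcases hd with rfl | rfl <;> exact plane_sqrt_three_four_of_mod_eight _ (by norm_num)
  · intro d hd
    simp only [Finset.mem_singleton] at hd
    subst hd
    exact not_colorable_two_plane_sqrt _ (by norm_num)

/-- THE OPEN `{3, 4}` ROWS BELOW `200`, REFINED: for `d = 83, 107, 155` the plane `ℚ(√d)²` is not `2`-colourable and is `4`-colourable, and its
3-INTEGRAL SUB-PLANE `T_d` (points `((A + B√d)/D, (C + E√d)/D)` with `3 ∤ D`) has chromatic number EXACTLY `3` — any `4`-chromatic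
unit-distance graph of `ℚ(√d)²` must use a unit vector with `3` in its denominator. -/
theorem quadratic_open_rows_threeIntegral :
    ∀ d ∈ ({83, 107, 155} : Finset ℕ),
      (¬ (planeUnitDistanceGraph.induce (fieldPoints ℚ⟮Real.sqrt d⟯)).Colorable 2 ∧
        (planeUnitDistanceGraph.induce (fieldPoints ℚ⟮Real.sqrt d⟯)).Colorable 4) ∧
      (planeUnitDistanceGraph.induce (threeIntegralPoints d)).chromaticNumber = 3 := by
  intro d hd
  simp only [Finset.mem_insert, Finset.mem_singleton] at hd
  rcases hd with rfl | rfl | rfl <;>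
    exact ⟨plane_sqrt_three_four_of_mod_eight _ (by norm_num), chromaticNumber_threeIntegralPoints _ (by norm_num)⟩

/-- For the record, `T_d ⊆ ℚ(√d)²` and `T_d` is `3`-colourable for EVERY `d ≡ 2 (mod 3)` — including the decided rows `11, 23, …, 191` with
`χ(ℚ(√d)²) = 4`, whose kernel witnesses therefore all carry a `3` in their common denominator (`30, 510, 120, 60, 390, …`). -/
theorem threeIntegral_part_of_value_four_rows :
    ∀ d ∈ ({11, 23, 35, 47, 59, 71, 83, 95, 107, 119, 131, 143, 155, 167, 179, 191} : Finset ℕ),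
      threeIntegralPoints d ⊆ fieldPoints ℚ⟮Real.sqrt d⟯ ∧ (planeUnitDistanceGraph.induce (threeIntegralPoints d)).chromaticNumber = 3 := by
  intro d hd
  simp only [Finset.mem_insert, Finset.mem_singleton] at hd
  rcases hd with rfl | rfl | rfl | rfl | rfl | rfl | rfl | rfl | rfl | rfl | rfl | rfl | rfl | rfl | rfl | rfl <;>
    exact ⟨threeIntegralPoints_subset_fieldPoints _, chromaticNumber_threeIntegralPoints _ (by norm_num)⟩

end Summit.Ventures.DiscreteObjects.UnitDistance
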